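import Literature.NumberTheory.Rogawski1990.SmoothTransferSplitPlaceGSide
import Literature.NumberTheory.Automorphic.GLnLeviOrbitalDescentExplicitBochner
import HarnessLib

/-!
# The `G`-side of the smooth transfer at a split place WITH THE IWASAWA CONSTANT EXPLICIT: under `(e_* ν)∕ν_M = C • π_*(κ ⊗ μ_U)`,
# `Φ([γ₀], φ; mG) = (C ‖det(1 − K_p)‖⁻¹ ‖det K_p‖).toReal • O^M_p((φ ∘ e⁻¹)^(P); ν_M∕ρ)` with THAT `C` (Rogawski (1990), Lemma 4.13.1 (a) p. 64, §4.9 p. 54)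

Topic `NumberTheory/Rogawski1990`; namespace `Literature.NumberTheory.Rogawski1990`.  THEOREMS ONLY (no definition, no instance, no notation, no named fact,
no `sorry`).  Cell `pub/hodgecm-mathlib`, line «CMCharIdentityTest» stub (a) `stub_splitTransferIsTransfer` (F0P3b desk, ED. 5): the transfer map is now the
NAMED ★ `UnitaryGroup.cmSplitTransfer` with constant `νG(K′)∕νH(K_H)`, so the `G`-side descent ★ B5-R `SmoothTransferSplitPlaceGSide` (whose constant is sealed
in `∃ C`) is re-run with the constant THREADED through the hypothesis `hqC : (e_* ν)∕ν_M = C • π_*(κ ⊗ μ_U)` (★ `exists_quotientMeasure_levi_eq_smul_map`; `C` is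
pinned by ★ `coe_mul_measure_eq_of_quotientMeasure_eq_smul_map`).  Same hypotheses-driven frame as ★ B5-R (any rank `N`, any two-block labelling `c′`, hermitian `J`):
* §1 `orbitalIntegral_eq_smul_orbitalIntegral_levi_of_eq_smul_map` — ★ B5-R §2 `exists_orbitalIntegral_eq_smul_orbitalIntegral_levi` with `∃ C` ↦ `hqC`
  (body verbatim; the descent step is ★ `integral_descConj_quotientMeasure_eq_smul_integral_levi_of_eq_smul_map`).
* §2 **`classOrbitalIntegral_eq_smul_orbitalIntegral_levi_of_split_of_eq_smul_map`** — ★ B5-R §3 `exists_classOrbitalIntegral_eq_smul_orbitalIntegral_levi_of_split`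
  with `∃ C` ↦ `hqC` for `ν′ = e_* ν` (body verbatim: (R3)(R4) ★ `exists_classOrbitalIntegral_eq_orbitalIntegral_of_split`, then §1).
HONEST LABEL: HC_CM is proved only modulo the printed citations (2 remaining named inputs hLiu418, h413) until rung 0 closes; this file proves none of them.

## References
* [Rogawski1990] J. D. Rogawski, *Automorphic Representations of Unitary Groups in Three Variables*, Ann. of Math. Stud. 123 (1990), §4.13 Lemma
  4.13.1 (a) p. 64 and its proof pp. 64–66; §4.3 (4.3.1) p. 43; §4.9 p. 54.
* [DeitmarEchterhoff2014] A. Deitmar, S. Echterhoff, *Principles of Harmonic Analysis*, 2nd ed. (2014), Thm. 1.5.3.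
* [Mok2014] C. P. Mok, *Endoscopic classification of representations of quasi-split unitary groups*, Mem. AMS 235 (2015), §1 p. 5.
-/

noncomputable section

open MeasureTheory Measure Set Filter Topology NumberField IsDedekindDomain Literature.MeasureTheory.Group
open scoped ENNReal NNReal Matrix MatrixGroups

namespace Literature.NumberTheory.Rogawski1990

open Literature.NumberTheory.Automorphic Literature.NumberTheory.Automorphic.UnitaryGroup
open Literature.NumberTheory.GaloisRepresentations.IsNonarchimedeanLocalField

section Split

variable {F E : Type} [Field F] [NumberField F] [Field E] [NumberField E] [Algebra F E] [Algebra.IsQuadraticExtension F E]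
  (c : E ≃ₐ[F] E) (N : ℕ) (J : Matrix (Fin N) (Fin N) E) {v : HeightOneSpectrum (𝓞 F)}
  (hc : c ≠ 1) (hJ : (J.map c)ᵀ = J) (w : PlacesOver E v) (hw : c • w.1 ≠ w.1) (hJw : IsUnit (placeForm J w.1))
  {c' : Fin N → Bool}
  [MeasurableSpace (w.1.adicCompletion E)] [BorelSpace (w.1.adicCompletion E)]
  [MeasurableSpace («local» E c N J v)] [BorelSpace («local» E c N J v)]
  [∀ γ : «local» E c N J v, MeasurableSpace (↥(«local» E c N J v) ⧸ Subgroup.centralizer ({γ} : Set («local» E c N J v)))]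
  [∀ γ : «local» E c N J v, BorelSpace (↥(«local» E c N J v) ⧸ Subgroup.centralizer ({γ} : Set («local» E c N J v)))]
  [MeasurableSpace (GL (Fin N) (w.1.adicCompletion E))] [BorelSpace (GL (Fin N) (w.1.adicCompletion E))]
  [LocallyCompactSpace (GL (Fin N) (w.1.adicCompletion E))] [SecondCountableTopology (GL (Fin N) (w.1.adicCompletion E))]
  [LocallyCompactSpace ↥(standardLeviGL (w.1.adicCompletion E) c')]
  [MeasurableSpace (GL (Fin N) (w.1.adicCompletion E) ⧸ standardLeviGL (w.1.adicCompletion E) c')]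
  [BorelSpace (GL (Fin N) (w.1.adicCompletion E) ⧸ standardLeviGL (w.1.adicCompletion E) c')]
  [∀ m : ↥(standardLeviGL (w.1.adicCompletion E) c'), MeasurableSpace (↥(standardLeviGL (w.1.adicCompletion E) c') ⧸ Subgroup.centralizer ({m} : Set ↥(standardLeviGL (w.1.adicCompletion E) c')))]
  [∀ m : ↥(standardLeviGL (w.1.adicCompletion E) c'), BorelSpace (↥(standardLeviGL (w.1.adicCompletion E) c') ⧸ Subgroup.centralizer ({m} : Set ↥(standardLeviGL (w.1.adicCompletion E) c')))]
  (ν : Measure («local» E c N J v)) [IsHaarMeasure ν] [ν.IsMulRightInvariant]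
  (mG : OrbitalMeasureFamily («local» E c N J v))
  (νM : Measure ↥(standardLeviGL (w.1.adicCompletion E) c')) [IsHaarMeasure νM] [νM.IsMulRightInvariant] [νM.IsInvInvariant]
  (κ : Measure ↥(glInt N (w.1.adicCompletion E))) [IsHaarMeasure κ]
  (μU : Measure ↥(unipotentRadicalGL (w.1.adicCompletion E) c')) [IsHaarMeasure μU] [SFinite μU]


/-! ## §1 Levi descent at a point of `P ∩ M`, constant explicit -/

omit [NumberField F] [Algebra.IsQuadraticExtension F E] in
/-- **LEVI DESCENT OF THE ORBITAL INTEGRAL AT A POINT OF `P ∩ M`, CANONICAL TORUS MEASURES, CONSTANT EXPLICIT**: ★ B5-R §2 with its `∃ C` replaced by the Iwasawa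
hypothesis `hqC : ν′∕ν_M = C • π_*(κ ⊗ μ_U)` — for `p ∈ P ∩ M` with closed class, `C_GL(p) ≤ M`, `det(1 − K_p) ≠ 0`, Haar inversion-invariant `ρ_G`, `ρ` with mass one on the
compact cores and `φ′ ∈ C_c(GL_N(E_w))`: `O_p(φ′; ν′∕ρ_G) = (C ‖det(1 − K_p)‖⁻¹ ‖det K_p‖).toReal • O^M_p((φ′)^(P); ν_M∕ρ)`.
[cite: Rogawski1990, §4.13 Lemma 4.13.1 (a) pp. 64–66; §4.3 (4.3.1) p. 43] [cite: DeitmarEchterhoff2014, Thm. 1.5.3] -/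
theorem orbitalIntegral_eq_smul_orbitalIntegral_levi_of_eq_smul_map
    (ν' : Measure (GL (Fin N) (w.1.adicCompletion E))) [IsHaarMeasure ν'] [ν'.IsMulRightInvariant] {C : ℝ≥0}
    (hqC : quotientMeasure (standardLeviGL (w.1.adicCompletion E) c') νM (isClosed_standardLeviGL (R := w.1.adicCompletion E) c') ν' =
      C • Measure.map (fun q : ↥(glInt N (w.1.adicCompletion E)) × ↥(unipotentRadicalGL (w.1.adicCompletion E) c') =>
        (QuotientGroup.mk ((q.1 : GL (Fin N) (w.1.adicCompletion E)) * (q.2 : GL (Fin N) (w.1.adicCompletion E))) :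
          GL (Fin N) (w.1.adicCompletion E) ⧸ standardLeviGL (w.1.adicCompletion E) c')) (κ.prod μU))
      (p : standardParabolicGL (w.1.adicCompletion E) c')
        (hpM : (p : GL (Fin N) (w.1.adicCompletion E)) ∈ standardLeviGL (w.1.adicCompletion E) c')
        (hO : IsClosed {g : GL (Fin N) (w.1.adicCompletion E) | ∃ y : GL (Fin N) (w.1.adicCompletion E), y * (p : GL (Fin N) (w.1.adicCompletion E)) * y⁻¹ = g})
        (hTM : Subgroup.centralizer ({(p : GL (Fin N) (w.1.adicCompletion E))} : Set (GL (Fin N) (w.1.adicCompletion E))) ≤ standardLeviGL (w.1.adicCompletion E) c')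
        (hp : (1 - Matrix.of
              fun q q' : {i : Fin N // c' i = false} × {j : Fin N // c' j = true} =>
                ((p : GL (Fin N) (w.1.adicCompletion E)) : Matrix (Fin N) (Fin N) (w.1.adicCompletion E)) q.1 q'.1 *
                  (((p⁻¹ : standardParabolicGL (w.1.adicCompletion E) c') : GL (Fin N) (w.1.adicCompletion E)) :
                    Matrix (Fin N) (Fin N) (w.1.adicCompletion E)) q'.2 q.2).det ≠ 0)
        [MeasurableSpace (GL (Fin N) (w.1.adicCompletion E) ⧸ Subgroup.centralizer ({(p : GL (Fin N) (w.1.adicCompletion E))} : Set (GL (Fin N) (w.1.adicCompletion E))))] [BorelSpace (GL (Fin N) (w.1.adicCompletion E) ⧸ Subgroup.centralizer ({(p : GL (Fin N) (w.1.adicCompletion E))} : Set (GL (Fin N) (w.1.adicCompletion E))))]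
        (ρG : Measure ↥(Subgroup.centralizer ({(p : GL (Fin N) (w.1.adicCompletion E))} : Set (GL (Fin N) (w.1.adicCompletion E))))) [IsHaarMeasure ρG] [ρG.IsInvInvariant]
        (hρG1 : ρG (compactCore ↥(Subgroup.centralizer ({(p : GL (Fin N) (w.1.adicCompletion E))} : Set (GL (Fin N) (w.1.adicCompletion E))))) = 1)
        (ρ : Measure ↥(Subgroup.centralizer ({(⟨(p : GL (Fin N) (w.1.adicCompletion E)), hpM⟩ : ↥(standardLeviGL (w.1.adicCompletion E) c'))} : Set ↥(standardLeviGL (w.1.adicCompletion E) c')))) [IsHaarMeasure ρ] [ρ.IsInvInvariant]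
        (hρ : ρ (compactCore ↥(Subgroup.centralizer ({(⟨(p : GL (Fin N) (w.1.adicCompletion E)), hpM⟩ : ↥(standardLeviGL (w.1.adicCompletion E) c'))} : Set ↥(standardLeviGL (w.1.adicCompletion E) c')))) = 1)
        (φ' : GL (Fin N) (w.1.adicCompletion E) → ℂ) (hφ'c : Continuous φ') (hφ's : HasCompactSupport φ') :
        orbitalIntegral (p : GL (Fin N) (w.1.adicCompletion E)) φ' (quotientMeasure (Subgroup.centralizer ({(p : GL (Fin N) (w.1.adicCompletion E))} : Set (GL (Fin N) (w.1.adicCompletion E)))) ρG (isClosed_coe_centralizer_singleton _) ν') =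
          ((C : ℝ≥0∞) * ((normAbs (w.1.adicCompletion E) ((1 - Matrix.of
              fun q q' : {i : Fin N // c' i = false} × {j : Fin N // c' j = true} =>
                ((p : GL (Fin N) (w.1.adicCompletion E)) : Matrix (Fin N) (Fin N) (w.1.adicCompletion E)) q.1 q'.1 *
                  (((p⁻¹ : standardParabolicGL (w.1.adicCompletion E) c') : GL (Fin N) (w.1.adicCompletion E)) :
                    Matrix (Fin N) (Fin N) (w.1.adicCompletion E)) q'.2 q.2).det)⁻¹ *
            normAbs (w.1.adicCompletion E) (Matrix.of
              fun q q' : {i : Fin N // c' i = false} × {j : Fin N // c' j = true} =>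
                ((p : GL (Fin N) (w.1.adicCompletion E)) : Matrix (Fin N) (Fin N) (w.1.adicCompletion E)) q.1 q'.1 *
                  (((p⁻¹ : standardParabolicGL (w.1.adicCompletion E) c') : GL (Fin N) (w.1.adicCompletion E)) :
                    Matrix (Fin N) (Fin N) (w.1.adicCompletion E)) q'.2 q.2).det : ℝ≥0) : ℝ≥0∞)).toReal •
          orbitalIntegral (⟨(p : GL (Fin N) (w.1.adicCompletion E)), hpM⟩ : ↥(standardLeviGL (w.1.adicCompletion E) c'))
            (fun m : ↥(standardLeviGL (w.1.adicCompletion E) c') =>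
              ∫ q' : ↥(glInt N (w.1.adicCompletion E)) × ↥(unipotentRadicalGL (w.1.adicCompletion E) c'),
                φ' ((q'.1 : GL (Fin N) (w.1.adicCompletion E)) * ((m : GL (Fin N) (w.1.adicCompletion E)) * (q'.2 : GL (Fin N) (w.1.adicCompletion E))) * (q'.1 : GL (Fin N) (w.1.adicCompletion E))⁻¹) ∂(κ.prod μU))
            (quotientMeasure (Subgroup.centralizer ({(⟨(p : GL (Fin N) (w.1.adicCompletion E)), hpM⟩ : ↥(standardLeviGL (w.1.adicCompletion E) c'))} : Set ↥(standardLeviGL (w.1.adicCompletion E) c'))) ρ (isClosed_coe_centralizer_singleton _) νM) := by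
  haveI hMc : IsClosed ((standardLeviGL (w.1.adicCompletion E) c' : Subgroup (GL (Fin N) (w.1.adicCompletion E))) : Set (GL (Fin N) (w.1.adicCompletion E))) := isClosed_standardLeviGL (R := (w.1.adicCompletion E)) c'
  haveI : BorelSpace ↥(standardLeviGL (w.1.adicCompletion E) c') := Subtype.borelSpace _
  have hpT : ∀ s ∈ Subgroup.centralizer ({(p : GL (Fin N) (w.1.adicCompletion E))} : Set (GL (Fin N) (w.1.adicCompletion E))), s * (p : GL (Fin N) (w.1.adicCompletion E)) = (p : GL (Fin N) (w.1.adicCompletion E)) * s := fun _ hg => Subgroup.mem_centralizer_singleton_iff.1 hg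
  haveI hTc : IsClosed (((Subgroup.centralizer ({(p : GL (Fin N) (w.1.adicCompletion E))} : Set (GL (Fin N) (w.1.adicCompletion E)))) : Subgroup (GL (Fin N) (w.1.adicCompletion E))) : Set (GL (Fin N) (w.1.adicCompletion E))) := isClosed_coe_centralizer_singleton _
  haveI : LocallyCompactSpace ↥(Subgroup.centralizer ({(p : GL (Fin N) (w.1.adicCompletion E))} : Set (GL (Fin N) (w.1.adicCompletion E)))) := hTc.isClosedEmbedding_subtypeVal.locallyCompactSpace
  letI : MeasurableSpace (↥(standardLeviGL (w.1.adicCompletion E) c') ⧸ (Subgroup.centralizer ({(p : GL (Fin N) (w.1.adicCompletion E))} : Set (GL (Fin N) (w.1.adicCompletion E)))).subgroupOf (standardLeviGL (w.1.adicCompletion E) c')) := borel _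
  haveI : BorelSpace (↥(standardLeviGL (w.1.adicCompletion E) c') ⧸ (Subgroup.centralizer ({(p : GL (Fin N) (w.1.adicCompletion E))} : Set (GL (Fin N) (w.1.adicCompletion E)))).subgroupOf (standardLeviGL (w.1.adicCompletion E) c')) := ⟨rfl⟩
  have hint : Integrable (descConj (p : GL (Fin N) (w.1.adicCompletion E)) (Subgroup.centralizer ({(p : GL (Fin N) (w.1.adicCompletion E))} : Set (GL (Fin N) (w.1.adicCompletion E)))) hpT φ') (quotientMeasure _ ρG (isClosed_coe_centralizer_singleton (p : GL (Fin N) (w.1.adicCompletion E))) ν') :=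
    integrable_descConj_of_isClosed _ hO hφ'c hφ's _
  haveI : IsHaarMeasure (Measure.map (Subgroup.subgroupOfEquivOfLe hTM).symm ρG) :=
    MulEquiv.isHaarMeasure_map ρG (Subgroup.subgroupOfEquivOfLe hTM).symm
      (continuous_subgroupOfEquivOfLe_symm _ _ hTM) (continuous_subgroupOfEquivOfLe _ _ hTM)
  haveI : (Measure.map (Subgroup.subgroupOfEquivOfLe hTM).symm ρG).IsInvInvariant :=
    isInvInvariant_map_mulEquiv (Subgroup.subgroupOfEquivOfLe hTM).symm (continuous_subgroupOfEquivOfLe_symm _ _ hTM).measurable ρG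
  haveI hTMc : IsClosed ((((Subgroup.centralizer ({(p : GL (Fin N) (w.1.adicCompletion E))} : Set (GL (Fin N) (w.1.adicCompletion E)))).subgroupOf (standardLeviGL (w.1.adicCompletion E) c')) : Subgroup ↥(standardLeviGL (w.1.adicCompletion E) c')) : Set ↥(standardLeviGL (w.1.adicCompletion E) c')) := isClosed_subgroupOf _ _ hTc
  haveI : LocallyCompactSpace ↥((Subgroup.centralizer ({(p : GL (Fin N) (w.1.adicCompletion E))} : Set (GL (Fin N) (w.1.adicCompletion E)))).subgroupOf (standardLeviGL (w.1.adicCompletion E) c')) := hTMc.isClosedEmbedding_subtypeVal.locallyCompactSpace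
  haveI : SFinite (Measure.map (Subgroup.subgroupOfEquivOfLe hTM).symm ρG) := inferInstance
  obtain ⟨-, hB⟩ := integral_descConj_quotientMeasure_eq_smul_integral_levi_of_eq_smul_map (w.1.adicCompletion E)
    (M := standardLeviGL (w.1.adicCompletion E) c') rfl hMc ν' νM κ μU hqC (Subgroup.centralizer ({(p : GL (Fin N) (w.1.adicCompletion E))} : Set (GL (Fin N) (w.1.adicCompletion E)))) (isClosed_coe_centralizer_singleton (p : GL (Fin N) (w.1.adicCompletion E))) hTM ρG
    (Measure.map (Subgroup.subgroupOfEquivOfLe hTM).symm ρG) rfl p hpM hpT hp φ' hφ'c hint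
  have hSwitch := integral_descConj_subgroupOf_centralizer_eq_orbitalIntegral (standardLeviGL (w.1.adicCompletion E) c') νM (p : GL (Fin N) (w.1.adicCompletion E)) hpM hTM ρG hρG1
    (Measure.map (Subgroup.subgroupOfEquivOfLe hTM).symm ρG) rfl (fun s hs => Subtype.ext (hpT (s : GL (Fin N) (w.1.adicCompletion E)) hs)) ρ hρ
    (fun m : ↥(standardLeviGL (w.1.adicCompletion E) c') =>
      ∫ q' : ↥(glInt N (w.1.adicCompletion E)) × ↥(unipotentRadicalGL (w.1.adicCompletion E) c'),
        φ' ((q'.1 : GL (Fin N) (w.1.adicCompletion E)) * ((m : GL (Fin N) (w.1.adicCompletion E)) * (q'.2 : GL (Fin N) (w.1.adicCompletion E))) * (q'.1 : GL (Fin N) (w.1.adicCompletion E))⁻¹) ∂(κ.prod μU))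
  rw [orbitalIntegral_eq_integral_descConj, hB, hSwitch]

/-! ## §3 The `G`-side at a split place -/


/-! ## §2 The `G`-side at a split place, constant explicit -/

/-- **B5-R WITH THE CONSTANT EXPLICIT — the `G`-side of the smooth transfer at a split place**: for `ν′ = e_* ν` under `hqC : ν′∕ν_M = C • π_*(κ ⊗ μ_U)`, for every regular class
`[γ₀]` of `U(J)(F_v)`, every admissible Levi point `p` over it (`q (e γ₀) q⁻¹ = p ∈ P ∩ M`, `C_GL(p) ≤ M`, `det(1 − K_p) ≠ 0`), every Haar inversion-invariant `ρ` on
`C_M(p)` with mass one on the compact core and every `φ ∈ C_c(U(J)(F_v))`: `Φ([γ₀], φ; mG) = (C ‖det(1 − K_p)‖⁻¹ ‖det K_p‖).toReal • O^M_p((φ ∘ e⁻¹)^(P); ν_M ∕ ρ)` (★ (R3)(R4)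
`exists_classOrbitalIntegral_eq_orbitalIntegral_of_split`, then §1 with `ν′ = e_* ν`). [cite: Rogawski1990, §4.13 Lemma 4.13.1 (a) pp. 64–66; §4.3 (4.3.1) p. 43; §4.9 p. 54]
[cite: DeitmarEchterhoff2014, Thm. 1.5.3] [cite: Mok2014, §1 Notation p. 5] -/
theorem classOrbitalIntegral_eq_smul_orbitalIntegral_levi_of_split_of_eq_smul_map
    (hcanG : mG.IsCanonical (fun γ : «local» E c N J v => IsRegularElt (γ : GL (Fin N) (LocalRing E v))) ν)
    (ν' : Measure (GL (Fin N) (w.1.adicCompletion E))) [IsHaarMeasure ν'] [ν'.IsMulRightInvariant] (hν' : ν' = ν.map (localSplitEquiv c J hc hJ w hw hJw))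
    {C : ℝ≥0}
    (hqC : quotientMeasure (standardLeviGL (w.1.adicCompletion E) c') νM (isClosed_standardLeviGL (R := w.1.adicCompletion E) c') ν' =
      C • Measure.map (fun q : ↥(glInt N (w.1.adicCompletion E)) × ↥(unipotentRadicalGL (w.1.adicCompletion E) c') =>
        (QuotientGroup.mk ((q.1 : GL (Fin N) (w.1.adicCompletion E)) * (q.2 : GL (Fin N) (w.1.adicCompletion E))) :
          GL (Fin N) (w.1.adicCompletion E) ⧸ standardLeviGL (w.1.adicCompletion E) c')) (κ.prod μU))
      (γ₀ : «local» E c N J v) (hreg : IsRegularElt (γ₀ : GL (Fin N) (LocalRing E v)))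
        (p : standardParabolicGL (w.1.adicCompletion E) c')
        (hpM : (p : GL (Fin N) (w.1.adicCompletion E)) ∈ standardLeviGL (w.1.adicCompletion E) c')
        (q : GL (Fin N) (w.1.adicCompletion E))
        (hq : q * localSplitEquiv c J hc hJ w hw hJw γ₀ * q⁻¹ = (p : GL (Fin N) (w.1.adicCompletion E)))
        (hTM : Subgroup.centralizer ({(p : GL (Fin N) (w.1.adicCompletion E))} : Set (GL (Fin N) (w.1.adicCompletion E))) ≤ standardLeviGL (w.1.adicCompletion E) c')
        (hp : (1 - Matrix.of
              fun q q' : {i : Fin N // c' i = false} × {j : Fin N // c' j = true} =>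
                ((p : GL (Fin N) (w.1.adicCompletion E)) : Matrix (Fin N) (Fin N) (w.1.adicCompletion E)) q.1 q'.1 *
                  (((p⁻¹ : standardParabolicGL (w.1.adicCompletion E) c') : GL (Fin N) (w.1.adicCompletion E)) :
                    Matrix (Fin N) (Fin N) (w.1.adicCompletion E)) q'.2 q.2).det ≠ 0)
        (ρ : Measure ↥(Subgroup.centralizer ({(⟨(p : GL (Fin N) (w.1.adicCompletion E)), hpM⟩ : ↥(standardLeviGL (w.1.adicCompletion E) c'))} : Set ↥(standardLeviGL (w.1.adicCompletion E) c')))) [IsHaarMeasure ρ] [ρ.IsInvInvariant]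
        (hρ : ρ (compactCore ↥(Subgroup.centralizer ({(⟨(p : GL (Fin N) (w.1.adicCompletion E)), hpM⟩ : ↥(standardLeviGL (w.1.adicCompletion E) c'))} : Set ↥(standardLeviGL (w.1.adicCompletion E) c')))) = 1)
        (φ : «local» E c N J v → ℂ) (hφc : Continuous φ) (hφs : HasCompactSupport φ) :
        classOrbitalIntegral mG φ (ConjClasses.mk γ₀) =
          ((C : ℝ≥0∞) * ((normAbs (w.1.adicCompletion E) ((1 - Matrix.of
              fun q q' : {i : Fin N // c' i = false} × {j : Fin N // c' j = true} =>
                ((p : GL (Fin N) (w.1.adicCompletion E)) : Matrix (Fin N) (Fin N) (w.1.adicCompletion E)) q.1 q'.1 *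
                  (((p⁻¹ : standardParabolicGL (w.1.adicCompletion E) c') : GL (Fin N) (w.1.adicCompletion E)) :
                    Matrix (Fin N) (Fin N) (w.1.adicCompletion E)) q'.2 q.2).det)⁻¹ *
            normAbs (w.1.adicCompletion E) (Matrix.of
              fun q q' : {i : Fin N // c' i = false} × {j : Fin N // c' j = true} =>
                ((p : GL (Fin N) (w.1.adicCompletion E)) : Matrix (Fin N) (Fin N) (w.1.adicCompletion E)) q.1 q'.1 *
                  (((p⁻¹ : standardParabolicGL (w.1.adicCompletion E) c') : GL (Fin N) (w.1.adicCompletion E)) :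
                    Matrix (Fin N) (Fin N) (w.1.adicCompletion E)) q'.2 q.2).det : ℝ≥0) : ℝ≥0∞)).toReal •
          orbitalIntegral (⟨(p : GL (Fin N) (w.1.adicCompletion E)), hpM⟩ : ↥(standardLeviGL (w.1.adicCompletion E) c'))
            (fun m : ↥(standardLeviGL (w.1.adicCompletion E) c') =>
              ∫ q' : ↥(glInt N (w.1.adicCompletion E)) × ↥(unipotentRadicalGL (w.1.adicCompletion E) c'),
                φ ((localSplitEquiv c J hc hJ w hw hJw).symm
                  ((q'.1 : GL (Fin N) (w.1.adicCompletion E)) * ((m : GL (Fin N) (w.1.adicCompletion E)) *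
                    (q'.2 : GL (Fin N) (w.1.adicCompletion E))) * (q'.1 : GL (Fin N) (w.1.adicCompletion E))⁻¹)) ∂(κ.prod μU))
            (quotientMeasure (Subgroup.centralizer ({(⟨(p : GL (Fin N) (w.1.adicCompletion E)), hpM⟩ : ↥(standardLeviGL (w.1.adicCompletion E) c'))} : Set ↥(standardLeviGL (w.1.adicCompletion E) c'))) ρ (isClosed_coe_centralizer_singleton _) νM) := by
  letI : MeasurableSpace (GL (Fin N) (w.1.adicCompletion E) ⧸ Subgroup.centralizer ({(p : GL (Fin N) (w.1.adicCompletion E))} : Set (GL (Fin N) (w.1.adicCompletion E)))) := borel _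
  haveI : BorelSpace (GL (Fin N) (w.1.adicCompletion E) ⧸ Subgroup.centralizer ({(p : GL (Fin N) (w.1.adicCompletion E))} : Set (GL (Fin N) (w.1.adicCompletion E)))) := ⟨rfl⟩
  obtain ⟨ρG, hρG, hρGi, hρG1, hA⟩ := exists_classOrbitalIntegral_eq_orbitalIntegral_of_split c N J hc hJ w hw hJw ν mG hcanG
    ν' hν' γ₀ hreg (p : GL (Fin N) (w.1.adicCompletion E)) q hq φ
  have hsep : (((p : GL (Fin N) (w.1.adicCompletion E)) : Matrix (Fin N) (Fin N) (w.1.adicCompletion E)).charpoly).Separable := by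
    have h := (isRegularElt_conj_iff q ((localSplitEquiv c J hc hJ w hw hJw) γ₀)).2 (isRegularElt_localSplitEquiv_of_isRegularElt c w J hc hw hJ hJw γ₀ hreg)
    rw [hq] at h
    exact h
  have hO : IsClosed {g : GL (Fin N) (w.1.adicCompletion E) | ∃ y : GL (Fin N) (w.1.adicCompletion E), y * (p : GL (Fin N) (w.1.adicCompletion E)) * y⁻¹ = g} :=
    Literature.LinearAlgebra.Matrix.isClosed_conjClass_of_charpoly_separable_field _ hsep
  have hφ'c : Continuous (φ ∘ ⇑(localSplitEquiv c J hc hJ w hw hJw).symm) := hφc.comp (localSplitEquiv c J hc hJ w hw hJw).symm.continuous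
  have hφ's : HasCompactSupport (φ ∘ ⇑(localSplitEquiv c J hc hJ w hw hJw).symm) := hφs.comp_homeomorph (localSplitEquiv c J hc hJ w hw hJw).symm.toHomeomorph
  rw [hA]
  exact orbitalIntegral_eq_smul_orbitalIntegral_levi_of_eq_smul_map N w (c' := c') νM κ μU ν' hqC
    p hpM hO hTM hp ρG hρG1 ρ hρ (φ ∘ ⇑(localSplitEquiv c J hc hJ w hw hJw).symm) hφ'c hφ's


end Split

end Literature.NumberTheory.Rogawski1990

end
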